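import Summits.QuantumFields.BalabanUV.T4Continuum.Support.NE7SliceIterationOrbitWeightedNL
import HarnessLib

/-!
# NE7SliceOrbitNL — THE (S1) ORBIT THEOREM ON THE NONLINEAR FRAME TARGET (memo ROAD-G103 §3, (R1′), file (B2)-6): `NE7SliceIterationOrbitWeighted.slice_orbit_w` VERBATIM with `Df ↦ D̃f`, the step
# `u ↦ e^{−ζ̃(u)}u`, the currency `τ + ω` (`ω ≥ 4C_Γ·M·b₁`) in the two contraction lines, the radius line `2S + 6M·δmax ≤ M·b₁`, and B7's Prop-4 regime for `W`, `U′` at `b₁` displayed — the Cauchy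
# engine `NE7DefectIterationCauchy.exists_orbit_limit` fed with `NE7SliceIterationOrbitWeightedNL.step_halves_defect_w_nl` ∕ `step_sizes_le_w_nl`

Cell `pub-balaban`, rung (B)+1 sub-cell t4, lineage `b2b-balaban-t4-ne7-p1`, generation 103 (CRUX PROVER NE7 #1 = OWNER of BINDER row NE7).  Memo `t4/b2b-balaban-t4-ne7-p1-g103/ROAD-G103.md` §3.
WHAT ([folklore]; 0 def, 0 sorry).  **`slice_orbit_w_nl`** (statement displayed; its outputs are the binders of NE7b's `NE7SliceLimitNL.limitNL_of_geometric`).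
HONEST FRAMING (page 1): the engine run on OUR state maps; nothing of Bałaban's asserted; NOT the initial state, NOT the slice condition of the limit, NOT NE7; spine 0∕9; finite T⁴ rung (B)+1 — NOT infinite
volume, NOT mass gap, NOT BetaPertH, NOT Clay (continuum YM on T⁴ ⇐ BetaPertH ∧ nine spine estimates, 0/9 proved).
-/

set_option autoImplicit false

open scoped BigOperators Matrix.Norms.L2Operator
open NormedSpace Finset Filter Topology

namespace Summit.QuantumFields.BalabanUV.T4Continuum.NE7SliceOrbitNL

open Literature.MathematicalPhysics.QuantumFieldTheory.Balaban1983to89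
open B7Prop1Explicit B7Prop2Explicit B7Prop3Flat MatrixLog
open T4AveragingDeficitWall (IsUnitaryCfg IsSkewDir SmallField vary curlAt)
open T4AveragingDeficitWallBoundary (IsPeriodicCfg periodBox)
open AveragingDeficitPeriodicCounting (IsPeriodicDir)
open AveragingDeficitTwoLevelPrep (prop1Radius)
open AveragingDeficitMultiLevelPrep (cavgIter LevelSmall tower)
open BlockAveragePushDirGauge (gaugeDir)
open NE3EnergyShapes (IsUnitarySite IsPeriodicSite)
open NE3RightInverseSupLetters (frameC supC)
open NE3HatInvCurlLetters (supCurlC)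
open NE3QbarIterCovLiftPrep (cruxC)
open NE3LinearisedAverageSup (curvSum)
open NE7MeanZeroGaugeSliceW (energyBlockLandauW)
open NE7DefectIterationCauchy (exists_orbit_limit mem_unitary_of_tendsto periodic_of_tendsto)
open SpreadLift (loopRad)
open NE7SliceIterationState (repLog cornerLog sizePair siteSup_le siteSup_nonneg bondSup_le bondSup_nonneg)
open NE7SliceIterationStateNL
open NE7SliceIterationStateFactsNL
open NE7SliceIterationStepNL
open NE7SliceIterationOrbit (region_sizes)
open NE7SliceIterationOrbitWeighted (weighted_region)
open NE7SliceIterationOrbitWeightedNL (step_halves_defect_w_nl step_sizes_le_w_nl)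

noncomputable section

variable {d : ℕ} {n : Type*} [Fintype n] [DecidableEq n]

section Orbit

variable [Nonempty n] {L : ℕ} (hL : 2 ≤ L) (k : ℕ) {W : Site d → Fin d → (Matrix n n ℂ)ˣ} {x : ℝ} (hWu : IsUnitaryCfg W) (hx : 0 ≤ x) (hs : LevelSmall d L k x)
  (hWx : SmallField W x) (N : ℕ) [NeZero N] (hθ : cruxC d L * (((L : ℝ) ^ (k + 1)) ^ 2 * x) < 1) (U' : Site d → Fin d → (Matrix n n ℂ)ˣ)
  (hWP : IsPeriodicCfg W ((tower L N (k + 1) : ℕ) : ℤ)) (hU'u : IsUnitaryCfg U') (hU'P : IsPeriodicCfg U' ((tower L N (k + 1) : ℕ) : ℤ))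
  (hd : 1 ≤ d) (κ₀ : Fin d) {α₀ αP x' b₁ ω : ℝ} (hα : 0 < α₀) (hα3 : C0 d * α₀ ≤ 1 / 3) (hα4 : 4 * α₀ ≤ c2' d L) (h52 : pdev W < α₀ * (((L : ℝ) ^ (k + 1))⁻¹) ^ 2)
  (hsmall : Real.exp (4 * (800 * ((d : ℝ) + 1) ^ 2 * ((d : ℝ) + 4)) * α₀) * (1 + 8 * (131072 * ((d : ℝ) + 1) ^ 2) * ((L : ℝ) ^ (k + 1) * b₁)) ≤ 2)
  (hc₃ : 2 * ((L : ℝ) ^ (k + 1) * b₁) ≤ c3 d L) (h100 : 100 * ((d : ℝ) * L * ((L : ℝ) ^ (k + 1) * b₁)) ≤ 1)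
  (hC16 : 16 * (131072 * ((d : ℝ) + 1) ^ 2) * ((L : ℝ) ^ (k + 1) * b₁) ≤ 1) (hsm : 2048 * (d : ℝ) * ((L : ℝ) ^ (k + 1) * b₁) ≤ 1)
  (hαP : 0 < αP) (hαP3 : C0 d * αP ≤ 1 / 3) (hαP2 : 2 * αP ≤ c2' d L) (hx'0 : 0 ≤ x') (hU'x : SmallField U' x') (hx'P : x' < αP * (((L : ℝ) ^ (k + 1))⁻¹) ^ 2)
  (hω0 : 0 ≤ ω) (hβ : 4 * (56 * ((d : ℝ) * L) ^ 2 + 16 * (131072 * ((d : ℝ) + 1) ^ 2) * ((d : ℝ) * L)) * ((L : ℝ) ^ (k + 1) * b₁) ≤ ω)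

/-! ## §2 The orbit and its limit on the nonlinear target (k-uniform regime) -/

include hWP hU'u hU'P hd κ₀ hα hα3 hα4 h52 hsmall hc₃ h100 hC16 hsm hαP hαP3 hαP2 hx'0 hU'x hx'P hω0 hβ in
/-- **THE (S1) ORBIT ON THE NONLINEAR FRAME TARGET CONVERGES, k-UNIFORM REGIME** — `NE7SliceIterationOrbitWeighted.slice_orbit_w` with `Df ↦ D̃f`, the step `u ↦ e^{−ζ̃(u)}u`, the two lines
`τ + ω ≤ 1`, `3·10⁶(1+16K)(1+d)³(1+frameC)(1+supC+supCurlC)·(τ + ω) ≤ 1∕2` (`ω ≥ 4C_Γ·M·b₁`), the radius line `2S + 6M·δmax ≤ M·b₁`, and B7's Prop-4 regime for `W`, `U′` at `b₁` displayed: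
from `u₀` on the working region with weighted sizes `≤ s₀`, `D̃f(u₀) ≤ δ₀ ≤ δmax`, `s₀ + 24dM·δ₀ ≤ S`, the orbit stays on the region, `D̃f(u_j) ≤ 2^{−j}δ₀`, weighted sizes `≤ s₀ + 24dM·δ₀`, and
converges sitewise to a unitary `(tower)`-periodic `u⋆` at rate `24dM·δ₀·2^{−j}`. [folklore] -/
theorem slice_orbit_w_nl
    (hθP : 4 * (d : ℝ) ^ 2 * ((L : ℝ) ^ (k + 1) - 1) ^ 2 * x + 16 * d * loopRad d L ((prop1Radius d L)^[k] x)
      + 4 * d * ((d : ℝ) - 1) * ((L : ℝ) ^ (k + 1) - 1) ^ 2 * x ≤ 1 / 2)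
    {K : ℝ} (hK : 0 ≤ K) (hKε : 16 * K * d * (((L : ℝ) ^ (k + 1)) ^ 2 * x) ≤ 1 / 2)
    (hLet : ∀ Y : Site d → Fin d → Matrix n n ℂ, Y ∈ energyBlockLandauW (d := d) (n := n) L N (k + 1) W →
      ∀ B : ℝ, (∀ (z : Site d) (μ ν : Fin d), μ ≠ ν → ‖curlAt W Y z μ ν‖ ≤ B) → ∀ (y : Site d) (κ : Fin d), ‖Y y κ‖ ≤ K * (L : ℝ) ^ (k + 1) * B)
    (hε : ((L : ℝ) ^ (k + 1)) ^ 2 * x ≤ 1) (hA : curvSum d L (k + 1) x ≤ 2 / 3 * L) (hθc : cruxC d L * (((L : ℝ) ^ (k + 1)) ^ 2 * x) ≤ 1 / 2)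
    {τ S δmax : ℝ} (hτ0 : 0 ≤ τ) (hτ1 : τ + ω ≤ 1) (hτs : 30000 * (d : ℝ) * τ ≤ 1)
    (hC : 3000000 * (1 + 16 * K) * (1 + (d : ℝ)) ^ 3 * (1 + frameC d L) * (1 + supC d L + supCurlC d L) * (τ + ω) ≤ 1 / 2)
    (hS4 : S ≤ 1 / 10000) (hSτ : S ≤ τ)
    (hδmax : 6 * (d : ℝ) * (L : ℝ) ^ (k + 1) * δmax ≤ 1 / 10000) (hMδ : (L : ℝ) ^ (k + 1) * δmax ≤ τ)
    (h4 : ((L : ℝ) ^ (k + 1)) ^ 2 * x ≤ τ) (h5 : ((L : ℝ) ^ (k + 1)) ^ 2 * x' ≤ τ) (hSb : 2 * S + 6 * ((L : ℝ) ^ (k + 1) * δmax) ≤ (L : ℝ) ^ (k + 1) * b₁)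
    {u₀ : Site d → (Matrix n n ℂ)ˣ} (hu₀ : IsUnitarySite u₀) (hu₀P : IsPeriodicSite u₀ ((tower L N (k + 1) : ℕ) : ℤ))
    (hgauge₀ : gaugeAct u₀ U' = vary W (repLog W U' u₀) 1)
    (hcorner₀ : ∀ z, ((u₀ (((L : ℤ) ^ (k + 1)) • z) : (Matrix n n ℂ)ˣ) : Matrix n n ℂ) = exp (cornerLog L k u₀ z))
    {s₀ δ₀ : ℝ} (hδ₀ : 0 ≤ δ₀) (hδ₀max : δ₀ ≤ δmax)
    (hs₀ : ‖((L : ℝ) ^ (k + 1) * (sizePair (L := L) (W := W) k N U' u₀).1, (sizePair (L := L) (W := W) k N U' u₀).2)‖ ≤ s₀)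
    (hd₀ : sliceDefectNL hL k hWu hx hs hWx N hθ U' u₀ ≤ δ₀)
    (hSsum : s₀ + 12 * d * (L : ℝ) ^ (k + 1) * δ₀ / (1 - 1 / 2) ≤ S) :
    ∃ ustar : Site d → (Matrix n n ℂ)ˣ, IsUnitarySite ustar ∧ IsPeriodicSite ustar ((tower L N (k + 1) : ℕ) : ℤ) ∧
      (∀ y, Tendsto (fun j => (((sliceStepNL hL k hWu hx hs hWx N hθ U')^[j] u₀ y : (Matrix n n ℂ)ˣ) : Matrix n n ℂ)) atTop (𝓝 ((ustar y : (Matrix n n ℂ)ˣ) : Matrix n n ℂ))) ∧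
      (∀ (y : Site d) (j : ℕ), ‖(((sliceStepNL hL k hWu hx hs hWx N hθ U')^[j] u₀ y : (Matrix n n ℂ)ˣ) : Matrix n n ℂ) - ((ustar y : (Matrix n n ℂ)ˣ) : Matrix n n ℂ)‖
        ≤ 12 * d * (L : ℝ) ^ (k + 1) * δ₀ * (1 / 2) ^ j / (1 - 1 / 2)) ∧
      ∀ j, (IsUnitarySite ((sliceStepNL hL k hWu hx hs hWx N hθ U')^[j] u₀) ∧ IsPeriodicSite ((sliceStepNL hL k hWu hx hs hWx N hθ U')^[j] u₀) ((tower L N (k + 1) : ℕ) : ℤ) ∧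
          gaugeAct ((sliceStepNL hL k hWu hx hs hWx N hθ U')^[j] u₀) U' = vary W (repLog W U' ((sliceStepNL hL k hWu hx hs hWx N hθ U')^[j] u₀)) 1 ∧
          (∀ z, ((((sliceStepNL hL k hWu hx hs hWx N hθ U')^[j] u₀) (((L : ℤ) ^ (k + 1)) • z) : (Matrix n n ℂ)ˣ) : Matrix n n ℂ)
            = exp (cornerLog L k ((sliceStepNL hL k hWu hx hs hWx N hθ U')^[j] u₀) z)) ∧
          sliceDefectNL hL k hWu hx hs hWx N hθ U' ((sliceStepNL hL k hWu hx hs hWx N hθ U')^[j] u₀) ≤ δmax) ∧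
        sliceDefectNL hL k hWu hx hs hWx N hθ U' ((sliceStepNL hL k hWu hx hs hWx N hθ U')^[j] u₀) ≤ (1 / 2) ^ j * δ₀ ∧
        ‖((L : ℝ) ^ (k + 1) * (sizePair (L := L) (W := W) k N U' ((sliceStepNL hL k hWu hx hs hWx N hθ U')^[j] u₀)).1,
            (sizePair (L := L) (W := W) k N U' ((sliceStepNL hL k hWu hx hs hWx N hθ U')^[j] u₀)).2)‖
          ≤ s₀ + 12 * d * (L : ℝ) ^ (k + 1) * δ₀ / (1 - 1 / 2) := by
  have hM0 : 0 < (L : ℝ) ^ (k + 1) := by positivity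
  have hM1 : (1 : ℝ) ≤ (L : ℝ) ^ (k + 1) := one_le_pow₀ (by exact_mod_cast (by omega : 1 ≤ L))
  have hreg : ∀ u : Site d → (Matrix n n ℂ)ˣ, IsPeriodicSite u ((tower L N (k + 1) : ℕ) : ℤ) →
      ‖((L : ℝ) ^ (k + 1) * (sizePair (L := L) (W := W) k N U' u).1, (sizePair (L := L) (W := W) k N U' u).2)‖ ≤ S →
      (L : ℝ) ^ (k + 1) * (sizePair (L := L) (W := W) k N U' u).1 ≤ S ∧ (sizePair (L := L) (W := W) k N U' u).2 ≤ S ∧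
      (∀ y κ, ‖repLog W U' u y κ‖ ≤ S) ∧ (∀ z, ‖cornerLog L k u z‖ ≤ S) ∧ (∀ y κ, ‖repLog W U' u y κ‖ ≤ b₁) := fun u huP hΦ => by
    obtain ⟨hX, hh, h10, -, -, -⟩ := region_sizes hL k N U' hWP hU'P huP
    obtain ⟨h1, h1', h2⟩ := weighted_region hL k N U' hΦ
    have hδmax0 : 0 ≤ (L : ℝ) ^ (k + 1) * δmax := mul_nonneg hM0.le (hδ₀.trans hδ₀max)
    have hSb' : (sizePair (L := L) (W := W) k N U' u).1 ≤ b₁ := by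
      have e1 : (L : ℝ) ^ (k + 1) * (sizePair (L := L) (W := W) k N U' u).1 ≤ (L : ℝ) ^ (k + 1) * b₁ := by
        linarith only [h1, hSb, hδmax0, h10.trans h1']
      exact le_of_mul_le_mul_left e1 hM0
    exact ⟨h1, h2, fun y κ => (hX y κ).trans h1', fun z => (hh z).trans h2, fun y κ => (hX y κ).trans hSb'⟩
  have hb₁0 : 0 ≤ b₁ := by
    obtain ⟨-, -, -, -, hXb⟩ := hreg u₀ hu₀P (hs₀.trans (by
      have : 0 ≤ 12 * (d : ℝ) * (L : ℝ) ^ (k + 1) * δ₀ / (1 - 1 / 2) := by positivity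
      linarith only [hSsum, this]))
    exact (norm_nonneg _).trans (hXb 0 κ₀)
  have hgf : ∀ u : Site d → (Matrix n n ℂ)ˣ, IsUnitarySite u → IsPeriodicSite u ((tower L N (k + 1) : ℕ) : ℤ) → gaugeAct u U' = vary W (repLog W U' u) 1 →
      (∀ z, ((u (((L : ℤ) ^ (k + 1)) • z) : (Matrix n n ℂ)ˣ) : Matrix n n ℂ) = exp (cornerLog L k u z)) → sliceDefectNL hL k hWu hx hs hWx N hθ U' u ≤ δmax →
      ‖((L : ℝ) ^ (k + 1) * (sizePair (L := L) (W := W) k N U' u).1, (sizePair (L := L) (W := W) k N U' u).2)‖ ≤ S →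
      (∀ y, ‖gaugeFunNL hL k hWu hx hs hWx N hθ U' u y‖ ≤ 6 * d * (L : ℝ) ^ (k + 1) * sliceDefectNL hL k hWu hx hs hWx N hθ U' u) ∧
        6 * (d : ℝ) * (L : ℝ) ^ (k + 1) * sliceDefectNL hL k hWu hx hs hWx N hθ U' u ≤ 1 / 10000 := fun u hu huP hgauge hcorner hDf hΦ => by
    obtain ⟨-, -, hXs, hhs, hXb⟩ := hreg u huP hΦ
    have hX8 : ∀ y κ, ‖repLog W U' u y κ‖ ≤ 1 / 8 := fun y κ => (hXs y κ).trans (by linarith only [hS4])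
    have hh8 : ∀ z, ‖cornerLog L k u z‖ ≤ 1 / 8 := fun z => (hhs z).trans (by linarith only [hS4])
    exact ⟨norm_gaugeFunNL_le hL k hWu hx hs hWx N hθ U' hWP hU'u hU'P hu huP hgauge hX8 hcorner hh8 hd hα hα3 hα4 h52 hb₁0 hXb hsmall hc₃ hsm hαP hαP3 hαP2 hx'0 hU'x hx'P hθP,
      (mul_le_mul_of_nonneg_left hDf (by positivity)).trans hδmax⟩
  have hS2 : S ≤ 1 / 100 := hS4.trans (by norm_num)
  have hmaps : ∀ u ∈ {u : Site d → (Matrix n n ℂ)ˣ | IsUnitarySite u ∧ IsPeriodicSite u ((tower L N (k + 1) : ℕ) : ℤ) ∧ gaugeAct u U' = vary W (repLog W U' u) 1 ∧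
      (∀ z, ((u (((L : ℤ) ^ (k + 1)) • z) : (Matrix n n ℂ)ˣ) : Matrix n n ℂ) = exp (cornerLog L k u z)) ∧ sliceDefectNL hL k hWu hx hs hWx N hθ U' u ≤ δmax},
      ‖((L : ℝ) ^ (k + 1) * (sizePair (L := L) (W := W) k N U' u).1, (sizePair (L := L) (W := W) k N U' u).2)‖ ≤ S → sliceStepNL hL k hWu hx hs hWx N hθ U' u ∈ {u : Site d → (Matrix n n ℂ)ˣ | IsUnitarySite u ∧ IsPeriodicSite u ((tower L N (k + 1) : ℕ) : ℤ) ∧ gaugeAct u U' = vary W (repLog W U' u) 1 ∧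
      (∀ z, ((u (((L : ℤ) ^ (k + 1)) • z) : (Matrix n n ℂ)ˣ) : Matrix n n ℂ) = exp (cornerLog L k u z)) ∧ sliceDefectNL hL k hWu hx hs hWx N hθ U' u ≤ δmax} := by
    rintro u ⟨hu, huP, hgauge, hcorner, hDf⟩ hΦ
    obtain ⟨hΦ1, hΦ2, hXs, hhs, hXb⟩ := hreg u huP hΦ
    obtain ⟨hσ, hσ4⟩ := hgf u hu huP hgauge hcorner hDf hΦ
    have hhalf := step_halves_defect_w_nl hL k hWu hx hs hWx N hθ U' hWP hU'u hU'P hd κ₀ hα hα3 hα4 h52 hsmall hc₃ h100 hC16 hsm hαP hαP3 hαP2 hx'0 hU'x hx'P hω0 hβ hθP hK hKε hLet hε hA hθc hτ0 hτ1 hτs hC hS4 hSτ hδmax hMδ h4 h5 hSb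
      hu huP hgauge hcorner hDf hΦ1 hΦ2
    have hDf0 := sliceDefectNL_nonneg hL k hWu hx hs hWx N hθ U' u
    have hX8 : ∀ y κ, ‖repLog W U' u y κ‖ ≤ 1 / 8 := fun y κ => (hXs y κ).trans (by linarith only [hS4])
    have hh8 : ∀ z, ‖cornerLog L k u z‖ ≤ 1 / 8 := fun z => (hhs z).trans (by linarith only [hS4])
    have hDf0' : (0 : ℝ) ≤ 0 := le_rfl
    refine ⟨?_, ?_, sliceStepNL_chart hL k hWu hx hs hWx N hθ U' hgauge hXs hS4 hσ hσ4, sliceStepNL_corner hL k hWu hx hs hWx N hθ U' hcorner hhs hS2 hσ hσ4, hhalf.trans (by linarith only [hDf, hDf0])⟩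
    · have hζs := (splitNL_holds hL k hWu hx hs hWx N hθ U' hWP hU'u hU'P hu huP hgauge hX8 hcorner hh8 hd hα hα3 hα4 h52 hb₁0 hXb hsmall hc₃ hsm hαP hαP3 hαP2 hx'0 hU'x hx'P).1
      intro y
      rw [sliceStepNL_apply]
      refine (unitaryUnits _).mul_mem ?_ (hu y)
      rw [mem_unitaryUnits, val_expUnit]
      letI : NormedAlgebra ℚ (Matrix n n ℂ) := NormedAlgebra.restrictScalars ℚ ℂ (Matrix n n ℂ)
      exact NormedSpace.exp_mem_unitary_of_mem_skewAdjoint ((skewAdjoint _).neg_mem (hζs y))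
    · have hζP := (splitNL_holds hL k hWu hx hs hWx N hθ U' hWP hU'u hU'P hu huP hgauge hX8 hcorner hh8 hd hα hα3 hα4 h52 hb₁0 hXb hsmall hc₃ hsm hαP hαP3 hαP2 hx'0 hU'x hx'P).2.1
      intro y i
      rw [sliceStepNL_apply, sliceStepNL_apply, hζP y i, huP y i]
  have hcontr : ∀ u ∈ {u : Site d → (Matrix n n ℂ)ˣ | IsUnitarySite u ∧ IsPeriodicSite u ((tower L N (k + 1) : ℕ) : ℤ) ∧ gaugeAct u U' = vary W (repLog W U' u) 1 ∧
      (∀ z, ((u (((L : ℤ) ^ (k + 1)) • z) : (Matrix n n ℂ)ˣ) : Matrix n n ℂ) = exp (cornerLog L k u z)) ∧ sliceDefectNL hL k hWu hx hs hWx N hθ U' u ≤ δmax},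
      ‖((L : ℝ) ^ (k + 1) * (sizePair (L := L) (W := W) k N U' u).1, (sizePair (L := L) (W := W) k N U' u).2)‖ ≤ S →
      sliceDefectNL hL k hWu hx hs hWx N hθ U' (sliceStepNL hL k hWu hx hs hWx N hθ U' u) ≤ 1 / 2 * sliceDefectNL hL k hWu hx hs hWx N hθ U' u := by
    rintro u ⟨hu, huP, hgauge, hcorner, hDf⟩ hΦ
    obtain ⟨hΦ1, hΦ2, -, -, -⟩ := hreg u huP hΦ
    have hhalf := step_halves_defect_w_nl hL k hWu hx hs hWx N hθ U' hWP hU'u hU'P hd κ₀ hα hα3 hα4 h52 hsmall hc₃ h100 hC16 hsm hαP hαP3 hαP2 hx'0 hU'x hx'P hω0 hβ hθP hK hKε hLet hε hA hθc hτ0 hτ1 hτs hC hS4 hSτ hδmax hMδ h4 h5 hSb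
      hu huP hgauge hcorner hDf hΦ1 hΦ2
    linarith only [hhalf]
  have hgrow : ∀ u ∈ {u : Site d → (Matrix n n ℂ)ˣ | IsUnitarySite u ∧ IsPeriodicSite u ((tower L N (k + 1) : ℕ) : ℤ) ∧ gaugeAct u U' = vary W (repLog W U' u) 1 ∧
      (∀ z, ((u (((L : ℤ) ^ (k + 1)) • z) : (Matrix n n ℂ)ˣ) : Matrix n n ℂ) = exp (cornerLog L k u z)) ∧ sliceDefectNL hL k hWu hx hs hWx N hθ U' u ≤ δmax},
      ‖((L : ℝ) ^ (k + 1) * (sizePair (L := L) (W := W) k N U' u).1, (sizePair (L := L) (W := W) k N U' u).2)‖ ≤ S →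
      ‖((L : ℝ) ^ (k + 1) * (sizePair (L := L) (W := W) k N U' (sliceStepNL hL k hWu hx hs hWx N hθ U' u)).1,
          (sizePair (L := L) (W := W) k N U' (sliceStepNL hL k hWu hx hs hWx N hθ U' u)).2)‖
        ≤ ‖((L : ℝ) ^ (k + 1) * (sizePair (L := L) (W := W) k N U' u).1, (sizePair (L := L) (W := W) k N U' u).2)‖
          + 12 * d * (L : ℝ) ^ (k + 1) * sliceDefectNL hL k hWu hx hs hWx N hθ U' u := by
    rintro u ⟨hu, huP, hgauge, hcorner, hDf⟩ hΦ
    obtain ⟨hΦ1, hΦ2, -, -, -⟩ := hreg u huP hΦ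
    exact step_sizes_le_w_nl hL k hWu hx hs hWx N hθ U' hWP hU'u hU'P hd hα hα3 hα4 h52 hsmall hc₃ hsm hαP hαP3 hαP2 hx'0 hU'x hx'P hθP hτs hS4 hSτ hδmax hSb
      hu huP hgauge hcorner hDf hΦ1 hΦ2
  have hdisp : ∀ u ∈ {u : Site d → (Matrix n n ℂ)ˣ | IsUnitarySite u ∧ IsPeriodicSite u ((tower L N (k + 1) : ℕ) : ℤ) ∧ gaugeAct u U' = vary W (repLog W U' u) 1 ∧
      (∀ z, ((u (((L : ℤ) ^ (k + 1)) • z) : (Matrix n n ℂ)ˣ) : Matrix n n ℂ) = exp (cornerLog L k u z)) ∧ sliceDefectNL hL k hWu hx hs hWx N hθ U' u ≤ δmax},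
      ‖((L : ℝ) ^ (k + 1) * (sizePair (L := L) (W := W) k N U' u).1, (sizePair (L := L) (W := W) k N U' u).2)‖ ≤ S →
      ∀ y : Site d, ‖((sliceStepNL hL k hWu hx hs hWx N hθ U' u y : (Matrix n n ℂ)ˣ) : Matrix n n ℂ) - ((u y : (Matrix n n ℂ)ˣ) : Matrix n n ℂ)‖ ≤ 12 * d * (L : ℝ) ^ (k + 1) * sliceDefectNL hL k hWu hx hs hWx N hθ U' u := by
    rintro u ⟨hu, huP, hgauge, hcorner, hDf⟩ hΦ y
    obtain ⟨hσ, hσ4⟩ := hgf u hu huP hgauge hcorner hDf hΦ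
    have h := norm_expUnit_neg_mul_sub_le (hu y) (hσ y) hσ4
    rw [← sliceStepNL_apply hL k hWu hx hs hWx N hθ U' u y] at h
    have hDf0 := sliceDefectNL_nonneg hL k hWu hx hs hWx N hθ U' u
    have hd0 : (0 : ℝ) ≤ d := by positivity
    linarith only [h, mul_nonneg (mul_nonneg hd0 hM0.le) hDf0]
  obtain ⟨v, hv, htail, horbit⟩ := exists_orbit_limit
    (K := {u : Site d → (Matrix n n ℂ)ˣ | IsUnitarySite u ∧ IsPeriodicSite u ((tower L N (k + 1) : ℕ) : ℤ) ∧ gaugeAct u U' = vary W (repLog W U' u) 1 ∧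
      (∀ z, ((u (((L : ℤ) ^ (k + 1)) • z) : (Matrix n n ℂ)ˣ) : Matrix n n ℂ) = exp (cornerLog L k u z)) ∧ sliceDefectNL hL k hWu hx hs hWx N hθ U' u ≤ δmax})
    (step := sliceStepNL hL k hWu hx hs hWx N hθ U')
    (Φ := fun u => ((L : ℝ) ^ (k + 1) * (sizePair (L := L) (W := W) k N U' u).1, (sizePair (L := L) (W := W) k N U' u).2))
    (Df := sliceDefectNL hL k hWu hx hs hWx N hθ U')
    (ev := fun (u : Site d → (Matrix n n ℂ)ˣ) (y : Site d) => ((u y : (Matrix n n ℂ)ˣ) : Matrix n n ℂ))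
    (θ := 1 / 2) (A := 12 * d * (L : ℝ) ^ (k + 1)) (B := 12 * d * (L : ℝ) ^ (k + 1)) (S := S) (s₀ := s₀) (δ₀ := δ₀) (u₀ := u₀)
    (by norm_num) (by norm_num) (by positivity) hδ₀ hSsum hmaps hcontr hgrow (by positivity) hdisp ⟨hu₀, hu₀P, hgauge₀, hcorner₀, hd₀.trans hδ₀max⟩ hs₀ hd₀
  have hvu : ∀ y, v y ∈ unitary (Matrix n n ℂ) := mem_unitary_of_tendsto (fun j => (horbit j).1.1) hv
  refine ⟨fun y => Unitary.toUnits ⟨v y, hvu y⟩, fun y => mem_unitaryUnits.mpr (hvu y), fun y i => ?_, fun y => hv y, fun y j => ?_,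
    fun j => ⟨(horbit j).1, (horbit j).2.1, (horbit j).2.2⟩⟩
  · exact Units.ext (periodic_of_tendsto (fun j => (horbit j).1.2.1) hv y i)
  · have h := htail y j
    rwa [dist_eq_norm] at h

end Orbit

end

end Summit.QuantumFields.BalabanUV.T4Continuum.NE7SliceOrbitNL
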